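import Summits.QuantumFields.YangMills.Theorems.BalabanLadderNTMarkovMirrorDefectResponseMoments
import HarnessLib

/-!
# Crux `UVSeamRec` (stmt-QuantumFields-20043), stub `stub_floorsEngine` (S-B) / crux `NT` clause (i):
# the clause-(i) package {MF, RM₁} along a unit map — two-point floors from the bare mirror floor and singleton
# RESPONSE MOMENTS, no `∀`-exterior law

Helper file (`--supports stmt-QuantumFields-20043`) of the seam stub-prover row `ym-20043-seam-s1`, sequel of
`…NTMarkovMirrorDefectResponseMoments` (`rblΔ_l2_eventually_of_responseMoments`: the mean-square chirality-defect
bound from the singleton response-moment law (RM₁) at a unit `a'` on a cube family femto in that unit) and of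
`…NTMarkovMirrorBareTypicalPackage` (`Q2_floor_of_bareFloor_l2`: {MF, RBLΔ-L²} ⇒ `Q2(θv, v) ≥ ε`).  General compact
`G`, any lattice representation `r`, any unit map `a → 0⁺`; nothing here is `SU(2)`-specific (the specialisation to
`(SU(2), rF, a/uRec → c₀)` with the verbatim (RM) shape of the registered `stub_responseMomentsOdd6` is the sequel
`…UVSeamRecFloorsEngineOfResponseMoments`).

* `Q2_floor_of_bareFloor_l2_responseMoments` — {MF(9ε/4) on the tori `Λ₅ ≤ aβ·L`, RM₁ at `a'`, femto-commensurability
  `b_β·a'β ≤ ℓ₁`, thickened support at physical depth `≥ κ`} ⇒ eventually in `β`, `ε ≤ Q2_{β,L,aβ}(θv, v)` on every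
  torus `2Λ₅ ≤ aβ·L`;
* `floorsTwoPoint_of_bareFloor_l2_responseMoments` — the two-point conjunct of the registered
  `UVSeamRec.stub_floorsEngine` (v4-F / v5(α)) for any `(G, r, a)`;
* `lowerBounds_fst_of_bareFloor_l2_responseMoments`, `nt_of_bareFloor_l2_responseMoments` — clause (i) of
  `LowerBounds G r a` and `Theses.BalabanLadder.NT` BY NAME given any clause-(ii) supplier (every compact simple `G`).

Located reading (owner's pen, no registry content): in Markov–mirror currency the (S-B) residual {BL6, MF, clause (ii)}
of record (R87 (1)) may be re-read as {RM₁ ⊂ RM (already owed by the slot for (S-A)), MF, clause (ii)} plus the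
femto-commensurability clause; the `∀`-exterior law BL6 is not needed.  Honest status: kernel-checked implications on
a CONDITIONAL chain; (RM) is an OPEN RG statement (E0′-K with background); MF and clause (ii) are crux `NT`'s open
mathematics (barrier `PerturbativeInvisibility`: every finite order of lattice perturbation theory gives `Q2 → 0` like
`g₀(a)⁴`).  Refs: Georgii 2011, Thm. 4.17; card E `Cruxes/NT/Ideas/markov-mirror-dirichlet-response.md`.
-/

set_option autoImplicit false

noncomputable section

open scoped SchwartzMap
open MeasureTheory Filter Topology
open Literature.MathematicalPhysics.QuantumFieldTheory Literature.MathematicalPhysics.QuantumLattice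
open Literature.Probability.LatticeModels
open Summit.QuantumFields.YangMills.Cruxes.OSLegsFromFemtoAndGap.DlrCollarTransfer

namespace Summit.QuantumFields.YangMills.Cruxes.NT.MarkovMirror

/-! ## The clause-(i) package {MF, RM₁} along a unit map -/

section Package

variable (G : Type) [Group G] [TopologicalSpace G] [IsTopologicalGroup G] [CompactSpace G]
  [MeasurableSpace G] [BorelSpace G] (r : LatticeRep G)

/-- **`Q2(θv, v) ≥ ε` for all large couplings and tori from {MF, RM₁}.**  A unit map `a > 0` with `a → 0`, ONE
compactly supported test function `v`, `ε > 0`; a positive-time cube family `Q_β` of physical size `≤ Λ₅` carrying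
the lattice support of `v(aβ·)` at depth `≥ 2` and its `e₀`-thickening at physical depth `≥ κ`, femto in the unit `a'`
of (RM₁); the bare mirror floor (MF) `9ε/4 ≤ Cov_T(Ṽ_v∘Θ₀, Ṽ_v)` on every torus `Λ₅ ≤ aβ·L`; and (RM₁) at `a'`.  Then
eventually in `β`, `ε ≤ Q2_{β,L,aβ}(θv, v)` on every torus `2Λ₅ ≤ aβ·L` (`rblΔ_l2_eventually_of_responseMoments` with
`η = ε/4` feeds `Q2_floor_of_bareFloor_l2`). [folklore] -/
theorem Q2_floor_of_bareFloor_l2_responseMoments (a a' : ℝ → ℝ) (ha₀ : ∀ β, 0 < a β) (ha : Tendsto a atTop (𝓝 0))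
    (v : 𝓢(EuclideanSpace ℝ (Fin 4), ℝ)) (hvK : HasCompactSupport (v : EuclideanSpace ℝ (Fin 4) → ℝ))
    {ε : ℝ} (hε : 0 < ε) {κ C₁ B β₁ ℓ₁ β₅ Λ₅ : ℝ} (hκ : 0 < κ) (hC₁ : 0 < C₁) (hℓ₁ : 0 < ℓ₁)
    (p : Fin 4 × Fin 4 → ℝ → ℝ) (c : ℝ → (Fin 4 → ℤ)) (b : ℝ → ℕ)
    (hgeom : ∀ β, β₅ ≤ β → 1 ≤ c β 0 ∧ ∀ j : Fin 4, (|((c β j : ℤ) : ℝ)| + (b β : ℝ) + 3) * a β ≤ Λ₅)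
    (hfemto : ∀ β, β₅ ≤ β → (b β : ℝ) * a' β ≤ ℓ₁)
    (hsupp : ∀ β, β₅ ≤ β → ∀ x : Fin 4 → ℤ, v (a β • siteToE x) ≠ 0 →
      x ∈ cubeSites (c β) (b β) ∧ 2 ≤ depth (c β) (b β) x)
    (hthick : ∀ β, β₅ ≤ β → ∀ x : Fin 4 → ℤ,
      (v (a β • siteToE x) ≠ 0 ∨ v (a β • siteToE (x + Pi.single 0 1)) ≠ 0) →
        x ∈ cubeSites (c β) (b β) ∧ κ / a β ≤ (depth (c β) (b β) x : ℝ))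
    (hRM : ∀ β : ℝ, β₁ ≤ β → ∀ (L : ℕ) (q : Fin 4 × Fin 4) (x : Fin 4 → ℤ) (R : ℕ), q.1 < q.2 → 1 ≤ R →
      (R : ℝ) * a' β ≤ ℓ₁ → 4 * R + 8 ≤ L →
      torusE G r β L (fun U => Real.exp ((R : ℝ) ^ 4 / C₁ *
        |kerE G r β (fun k => x k - (R + 1)) (2 * R + 3) U (plane G r q x) - p q β|)) ≤ Real.exp B)
    (hMF : ∀ β, β₅ ≤ β → ∀ L : ℕ, Λ₅ ≤ a β * L →
      9 * ε / 4 ≤ torusE G r β L (fun V =>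
          (∑ y ∈ cubeSites (c β) (b β), v (a β • siteToE y) * dens G r y (cfgReflect V)) *
            ∑ y ∈ cubeSites (c β) (b β), v (a β • siteToE y) * dens G r y V) -
        torusE G r β L (fun V => ∑ y ∈ cubeSites (c β) (b β), v (a β • siteToE y) * dens G r y (cfgReflect V)) *
          torusE G r β L (fun V => ∑ y ∈ cubeSites (c β) (b β), v (a β • siteToE y) * dens G r y V)) :
    ∃ β₈ : ℝ, ∀ β, β₈ ≤ β → ∀ L : ℕ, 2 * Λ₅ ≤ a β * L → ε ≤ Q2 G r β L (a β) (thetaTest 4 v) v := by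
  obtain ⟨β₇, hΔ2⟩ := rblΔ_l2_eventually_of_responseMoments G r a a' ha₀ ha v hvK hκ hC₁ hℓ₁ p c b hgeom hfemto
    hsupp hthick hRM (show 0 < ε / 4 by positivity)
  -- `Λ₅ ≥ 0`, so the larger tori `2Λ₅ ≤ aβ·L` are among the tori `Λ₅ ≤ aβ·L`
  have hΛ : ∀ β, β₅ ≤ β → 0 ≤ Λ₅ := fun β hβ => by
    obtain ⟨-, hsize⟩ := hgeom β hβ
    have h0 : 0 ≤ |((c β 0 : ℤ) : ℝ)| := abs_nonneg _
    nlinarith [hsize 0, ha₀ β]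
  refine ⟨max (max β₅ β₇) 0, fun β hβ L hL => ?_⟩
  have hβ₅ : β₅ ≤ β := le_trans (le_trans (le_max_left _ _) (le_max_left _ _)) hβ
  have hΛ0 := hΛ β hβ₅
  exact Q2_floor_of_bareFloor_l2 G r a ha₀ v hε (β₅ := max β₅ β₇) (Λ₅ := 2 * Λ₅) c b
    (fun β => ∑ x ∈ cubeSites (c β) (b β), (v (a β • siteToE (x + Pi.single 0 1)) - v (a β • siteToE x)) *
      ∑ q : {q : Fin 4 × Fin 4 // q.1 < q.2}, (if q.1.1 = 0 then p q.1 β else 0))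
    (fun β hβ => ⟨(hgeom β (le_trans (le_max_left _ _) hβ)).1, fun j =>
      ((hgeom β (le_trans (le_max_left _ _) hβ)).2 j).trans (by linarith [hΛ β (le_trans (le_max_left _ _) hβ)])⟩)
    (fun β hβ => hsupp β (le_trans (le_max_left _ _) hβ))
    (fun β hβ L hL => hΔ2 β (le_trans (le_max_right _ _) hβ) L hL)
    (fun β hβ L hL => hMF β (le_trans (le_max_left _ _) hβ) L
      (by linarith [hΛ β (le_trans (le_max_left _ _) hβ)]))
    β hβ L hL

/-- **The two-point conjunct of `UVSeamRec.stub_floorsEngine` (v4-F / v5(α)) from {MF, RM₁}** (compact support of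
the witness and positive-time support recorded; any `(G, r, a)` — at `(SU(2), rF, a ≍ c₀·uRec)` it is the registered
conjunct; the femto-commensurability clause `b_β·a'β ≤ ℓ₁` ties the cube family to the unit of (RM₁)). [folklore] -/
theorem floorsTwoPoint_of_bareFloor_l2_responseMoments (a a' : ℝ → ℝ) (ha₀ : ∀ β, 0 < a β)
    (ha : Tendsto a atTop (𝓝 0))
    (v : 𝓢(EuclideanSpace ℝ (Fin 4), ℝ)) (hvK : HasCompactSupport (v : EuclideanSpace ℝ (Fin 4) → ℝ))
    (hv : tsupport (v : EuclideanSpace ℝ (Fin 4) → ℝ) ⊆ {y | 0 < y 0})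
    {ε : ℝ} (hε : 0 < ε) {κ C₁ B β₁ ℓ₁ β₅ Λ₅ : ℝ} (hκ : 0 < κ) (hC₁ : 0 < C₁) (hℓ₁ : 0 < ℓ₁)
    (p : Fin 4 × Fin 4 → ℝ → ℝ) (c : ℝ → (Fin 4 → ℤ)) (b : ℝ → ℕ)
    (hgeom : ∀ β, β₅ ≤ β → 1 ≤ c β 0 ∧ ∀ j : Fin 4, (|((c β j : ℤ) : ℝ)| + (b β : ℝ) + 3) * a β ≤ Λ₅)
    (hfemto : ∀ β, β₅ ≤ β → (b β : ℝ) * a' β ≤ ℓ₁)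
    (hsupp : ∀ β, β₅ ≤ β → ∀ x : Fin 4 → ℤ, v (a β • siteToE x) ≠ 0 →
      x ∈ cubeSites (c β) (b β) ∧ 2 ≤ depth (c β) (b β) x)
    (hthick : ∀ β, β₅ ≤ β → ∀ x : Fin 4 → ℤ,
      (v (a β • siteToE x) ≠ 0 ∨ v (a β • siteToE (x + Pi.single 0 1)) ≠ 0) →
        x ∈ cubeSites (c β) (b β) ∧ κ / a β ≤ (depth (c β) (b β) x : ℝ))
    (hRM : ∀ β : ℝ, β₁ ≤ β → ∀ (L : ℕ) (q : Fin 4 × Fin 4) (x : Fin 4 → ℤ) (R : ℕ), q.1 < q.2 → 1 ≤ R →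
      (R : ℝ) * a' β ≤ ℓ₁ → 4 * R + 8 ≤ L →
      torusE G r β L (fun U => Real.exp ((R : ℝ) ^ 4 / C₁ *
        |kerE G r β (fun k => x k - (R + 1)) (2 * R + 3) U (plane G r q x) - p q β|)) ≤ Real.exp B)
    (hMF : ∀ β, β₅ ≤ β → ∀ L : ℕ, Λ₅ ≤ a β * L →
      9 * ε / 4 ≤ torusE G r β L (fun V =>
          (∑ y ∈ cubeSites (c β) (b β), v (a β • siteToE y) * dens G r y (cfgReflect V)) *
            ∑ y ∈ cubeSites (c β) (b β), v (a β • siteToE y) * dens G r y V) -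
        torusE G r β L (fun V => ∑ y ∈ cubeSites (c β) (b β), v (a β • siteToE y) * dens G r y (cfgReflect V)) *
          torusE G r β L (fun V => ∑ y ∈ cubeSites (c β) (b β), v (a β • siteToE y) * dens G r y V)) :
    ∃ (v : 𝓢(EuclideanSpace ℝ (Fin 4), ℝ)) (ε β₅ Λ₅ : ℝ),
      HasCompactSupport (v : EuclideanSpace ℝ (Fin 4) → ℝ) ∧
      tsupport (v : EuclideanSpace ℝ (Fin 4) → ℝ) ⊆ {y : EuclideanSpace ℝ (Fin 4) | 0 < y 0} ∧ 0 < ε ∧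
      ∀ β : ℝ, β₅ ≤ β → ∀ L : ℕ, Λ₅ ≤ a β * L → ε ≤ Q2 G r β L (a β) (thetaTest 4 v) v := by
  obtain ⟨β₈, h⟩ := Q2_floor_of_bareFloor_l2_responseMoments G r a a' ha₀ ha v hvK hε hκ hC₁ hℓ₁ p c b hgeom hfemto
    hsupp hthick hRM hMF
  exact ⟨v, ε, β₈, 2 * Λ₅, hvK, hv, hε, h⟩

/-- **Clause (i) of `LowerBounds G r a` from {MF, RM₁}** (positive-time support of the witness recorded).
[folklore] -/
theorem lowerBounds_fst_of_bareFloor_l2_responseMoments (a a' : ℝ → ℝ) (ha₀ : ∀ β, 0 < a β)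
    (ha : Tendsto a atTop (𝓝 0))
    (v : 𝓢(EuclideanSpace ℝ (Fin 4), ℝ)) (hvK : HasCompactSupport (v : EuclideanSpace ℝ (Fin 4) → ℝ))
    (hv : tsupport (v : EuclideanSpace ℝ (Fin 4) → ℝ) ⊆ {y | 0 < y 0})
    {ε : ℝ} (hε : 0 < ε) {κ C₁ B β₁ ℓ₁ β₅ Λ₅ : ℝ} (hκ : 0 < κ) (hC₁ : 0 < C₁) (hℓ₁ : 0 < ℓ₁)
    (p : Fin 4 × Fin 4 → ℝ → ℝ) (c : ℝ → (Fin 4 → ℤ)) (b : ℝ → ℕ)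
    (hgeom : ∀ β, β₅ ≤ β → 1 ≤ c β 0 ∧ ∀ j : Fin 4, (|((c β j : ℤ) : ℝ)| + (b β : ℝ) + 3) * a β ≤ Λ₅)
    (hfemto : ∀ β, β₅ ≤ β → (b β : ℝ) * a' β ≤ ℓ₁)
    (hsupp : ∀ β, β₅ ≤ β → ∀ x : Fin 4 → ℤ, v (a β • siteToE x) ≠ 0 →
      x ∈ cubeSites (c β) (b β) ∧ 2 ≤ depth (c β) (b β) x)
    (hthick : ∀ β, β₅ ≤ β → ∀ x : Fin 4 → ℤ,
      (v (a β • siteToE x) ≠ 0 ∨ v (a β • siteToE (x + Pi.single 0 1)) ≠ 0) →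
        x ∈ cubeSites (c β) (b β) ∧ κ / a β ≤ (depth (c β) (b β) x : ℝ))
    (hRM : ∀ β : ℝ, β₁ ≤ β → ∀ (L : ℕ) (q : Fin 4 × Fin 4) (x : Fin 4 → ℤ) (R : ℕ), q.1 < q.2 → 1 ≤ R →
      (R : ℝ) * a' β ≤ ℓ₁ → 4 * R + 8 ≤ L →
      torusE G r β L (fun U => Real.exp ((R : ℝ) ^ 4 / C₁ *
        |kerE G r β (fun k => x k - (R + 1)) (2 * R + 3) U (plane G r q x) - p q β|)) ≤ Real.exp B)
    (hMF : ∀ β, β₅ ≤ β → ∀ L : ℕ, Λ₅ ≤ a β * L →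
      9 * ε / 4 ≤ torusE G r β L (fun V =>
          (∑ y ∈ cubeSites (c β) (b β), v (a β • siteToE y) * dens G r y (cfgReflect V)) *
            ∑ y ∈ cubeSites (c β) (b β), v (a β • siteToE y) * dens G r y V) -
        torusE G r β L (fun V => ∑ y ∈ cubeSites (c β) (b β), v (a β • siteToE y) * dens G r y (cfgReflect V)) *
          torusE G r β L (fun V => ∑ y ∈ cubeSites (c β) (b β), v (a β • siteToE y) * dens G r y V)) :
    ∃ (v : 𝓢(EuclideanSpace ℝ (Fin 4), ℝ)) (ε β₅ Λ₅ : ℝ),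
      tsupport (v : EuclideanSpace ℝ (Fin 4) → ℝ) ⊆ {y : EuclideanSpace ℝ (Fin 4) | 0 < y 0} ∧ 0 < ε ∧
      ∀ β : ℝ, β₅ ≤ β → ∀ L : ℕ, Λ₅ ≤ a β * L → ε ≤ Q2 G r β L (a β) (thetaTest 4 v) v := by
  obtain ⟨β₈, h⟩ := Q2_floor_of_bareFloor_l2_responseMoments G r a a' ha₀ ha v hvK hε hκ hC₁ hℓ₁ p c b hgeom hfemto
    hsupp hthick hRM hMF
  exact ⟨v, ε, β₈, 2 * Λ₅, hv, hε, h⟩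

end Package

/-- **`NT` BY NAME from {MF, RM₁} and any clause-(ii) supplier** (every compact simple `G`, Borel σ-algebra; the
unit `a` of the floors and the unit `a'` of (RM₁) tied by the femto-commensurability clause). [folklore] -/
theorem nt_of_bareFloor_l2_responseMoments
    (h : ∀ (G : Type) [Group G] [TopologicalSpace G] [IsTopologicalGroup G] [CompactSpace G],
      IsCompactSimpleLieGroup G → letI : MeasurableSpace G := borel G; haveI : BorelSpace G := ⟨rfl⟩;
      ∃ (r : LatticeRep G) (a a' : ℝ → ℝ), (∀ β, 0 < a β) ∧ Tendsto a atTop (𝓝 0) ∧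
        (∃ (v : 𝓢(EuclideanSpace ℝ (Fin 4), ℝ)) (ε κ C₁ B β₁ ℓ₁ β₅ Λ₅ : ℝ) (p : Fin 4 × Fin 4 → ℝ → ℝ)
          (c : ℝ → (Fin 4 → ℤ)) (b : ℝ → ℕ),
          HasCompactSupport (v : EuclideanSpace ℝ (Fin 4) → ℝ) ∧
          tsupport (v : EuclideanSpace ℝ (Fin 4) → ℝ) ⊆ {y | 0 < y 0} ∧ 0 < ε ∧ 0 < κ ∧ 0 < C₁ ∧ 0 < ℓ₁ ∧
          (∀ β, β₅ ≤ β → 1 ≤ c β 0 ∧ ∀ j : Fin 4, (|((c β j : ℤ) : ℝ)| + (b β : ℝ) + 3) * a β ≤ Λ₅) ∧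
          (∀ β, β₅ ≤ β → (b β : ℝ) * a' β ≤ ℓ₁) ∧
          (∀ β, β₅ ≤ β → ∀ x : Fin 4 → ℤ, v (a β • siteToE x) ≠ 0 →
            x ∈ cubeSites (c β) (b β) ∧ 2 ≤ depth (c β) (b β) x) ∧
          (∀ β, β₅ ≤ β → ∀ x : Fin 4 → ℤ,
            (v (a β • siteToE x) ≠ 0 ∨ v (a β • siteToE (x + Pi.single 0 1)) ≠ 0) →
              x ∈ cubeSites (c β) (b β) ∧ κ / a β ≤ (depth (c β) (b β) x : ℝ)) ∧
          (∀ β : ℝ, β₁ ≤ β → ∀ (L : ℕ) (q : Fin 4 × Fin 4) (x : Fin 4 → ℤ) (R : ℕ), q.1 < q.2 → 1 ≤ R →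
            (R : ℝ) * a' β ≤ ℓ₁ → 4 * R + 8 ≤ L →
            torusE G r β L (fun U => Real.exp ((R : ℝ) ^ 4 / C₁ *
              |kerE G r β (fun k => x k - (R + 1)) (2 * R + 3) U (plane G r q x) - p q β|)) ≤ Real.exp B) ∧
          (∀ β, β₅ ≤ β → ∀ L : ℕ, Λ₅ ≤ a β * L →
            9 * ε / 4 ≤ torusE G r β L (fun V =>
                (∑ y ∈ cubeSites (c β) (b β), v (a β • siteToE y) * dens G r y (cfgReflect V)) *
                  ∑ y ∈ cubeSites (c β) (b β), v (a β • siteToE y) * dens G r y V) -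
              torusE G r β L (fun V => ∑ y ∈ cubeSites (c β) (b β), v (a β • siteToE y) * dens G r y (cfgReflect V)) *
                torusE G r β L (fun V => ∑ y ∈ cubeSites (c β) (b β), v (a β • siteToE y) * dens G r y V))) ∧
        (∃ (f g h : 𝓢(EuclideanSpace ℝ (Fin 4), ℝ)) (ε β₅ Λ₅ : ℝ), Disjoint (tsupport f) (tsupport g) ∧
          Disjoint (tsupport g) (tsupport h) ∧ Disjoint (tsupport f) (tsupport h) ∧ 0 < ε ∧
          ∀ β : ℝ, β₅ ≤ β → ∀ L : ℕ, Λ₅ ≤ a β * L → ε ≤ |Q3 G r β L (a β) f g h|)) :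
    Summit.QuantumFields.YangMills.Theses.BalabanLadder.NT := by
  intro G _ _ _ _ hG
  letI : MeasurableSpace G := borel G
  haveI : BorelSpace G := ⟨rfl⟩
  obtain ⟨r, a, a', ha₀, ha, ⟨v, ε, κ, C₁, B, β₁, ℓ₁, β₅, Λ₅, p, c, b, hvK, hv, hε, hκ, hC₁, hℓ₁, hgeom, hfemto,
    hsupp, hthick, hRM, hMF⟩, h3⟩ := h G hG
  exact ⟨r, a, ha₀, ha, lowerBounds_fst_of_bareFloor_l2_responseMoments G r a a' ha₀ ha v hvK hv hε hκ hC₁ hℓ₁ p c b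
    hgeom hfemto hsupp hthick hRM hMF, h3⟩


end Summit.QuantumFields.YangMills.Cruxes.NT.MarkovMirror

end
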